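import Mathlib
import Summits.Ventures.HodgeRepro2.T5QuadraticNormIndex
import Summits.Ventures.HodgeRepro2.T5LocalNormCharacter
import Summits.Ventures.HodgeRepro2.T5UnitsResidueQuotient
import Summits.Ventures.HodgeRepro2.T5AdicCompletionResidueField
import Summits.Ventures.HodgeRepro2.T5NormGroupOpen
import Summits.Ventures.HodgeRepro2.T5TameNormCharNegOne

/-!
# `η_v` at EVERY finite non-split place: the norm index theorem, ramification, conductor, continuity

`Kv ⊆ Lw` Mathlib's completions with `[Lw : Kv] = 2` and `σ ≠ 1` the non-trivial automorphism — no
uniformiser, no ramification hypothesis, no «`2` is a unit» in the main statements; `η_v` is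
`T5LocalNormCharacter.normChar v w σ hind` with `hind` the norm index theorem below.

§Index. **`index_normGroup_eq_two (h2) (hσ) : (normGroup v w σ).index = 2`** at EVERY non-split
place: uniformisers `ϖ` of `O_Kv` and `π` of `O_Lw` exist (`exists_irreducible_adicCompletionIntegers`,
Mathlib's `intValuation_exists_uniformizer` + the cell's `irreducible_iff_val_eq_exp_neg_one`); if
`alg ϖ` is irreducible the place is INERT (`T5AdicCompletionNormGroup.index_normGroup_eq_two`),
otherwise RAMIFIED of any residue characteristic (`T5QuadraticNormIndex.index_normGroup_eq_two_of_ramified`).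
`normGroup_ne_top`, `normChar_eq_one_iff`.

§Ramified / §Unramified. At a ramified place some UNIT is not a norm
(`exists_mem_adicIntegerUnits_notMem_normGroup`: `normGroup ⊔ O_Kvˣ = ⊤` by the uniformiser `N π`,
`normGroup ≠ ⊤`), and **`adicIntegerUnits_le_normGroup_iff : O_Kvˣ ≤ normGroup v w σ ↔ Irreducible (alg ϖ)`**
— `η_v` is unramified iff the place is.

§WildConductor. At a ramified place of residue characteristic `2` (`h2n : ¬ IsUnit (2 : O_Kv)`) some
PRINCIPAL unit is not a norm (**`exists_val_sub_one_lt_one_notMem_normGroup`**): the residue field has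
characteristic `2` (`charP_residueField_two`), so `[O_Kvˣ : U¹] = |k| − 1` is odd
(`odd_index_principalUnits`, `T5UnitsResidueQuotient.index_principalUnits`), while the norm group
pulled back to `O_Kvˣ` has index `2` (`index_comap_normGroup_eq_two`, `Subgroup.index_comap` and the
transfer of `T5RamifiedNormTransfer`) — if `U¹` were inside it, `2` would divide an odd number. So the
conductor exponent of `η_v` is `≥ 2` at a wild place, whereas it is `1` at a tame place
(`T5LocalNormCharacter.normChar_eq_one_of_val_sub_one_lt_one`) and `0` at an inert place; the upper
bound `≤ 2 v_K(2) + 1` is `T5NormGroupOpen.mem_normGroup_of_val_sub_one_lt_val_four`.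

§Summary (with `hind := index_normGroup_eq_two v w σ h2 hσ`): `normChar_continuous`, `normChar_sq`,
`normChar_eq_one_of_val_sub_one_lt_val_four`, `forall_normChar_eq_one_iff_irreducible`,
`exists_mem_adicIntegerUnits_normChar_eq_neg_one'` (ramified), `exists_val_sub_one_lt_one_normChar_eq_neg_one'`
(wild), `tame_normChar_summary` (trivial on `1 + 𝔪`, and `η_v(−1) = −1 ⟺ q_v ≡ 3 (mod 4)`,
`T5TameNormCharNegOne`).

Print: Serre, *Local Fields*, Ch. XV §2 Cor. 2 (`U_K^f ⊆ N Lˣ` with `f = φ(c) + 1`: `f = 1` exactly in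
the tame case, `f ≥ 2` in the wild case) and Ch. IV §2 (the filtration `U^{(n)}`); the norm index
theorem itself is the Herbrand-quotient argument of Serre, *Local Class Field Theory*
(Cassels–Fröhlich Ch. VI) §1.4 Cor. 1 carried out in `T5TateComparison` … `T5QuadraticNormIndex`.
No exact value of the wild conductor is computed here (`f = d(Lw/Kv)` is not attempted).

Declaration per README §8(d): «uses an L-value-free non-vanishing device: NO».
-/

namespace Summit.Ventures.HodgeRepro2.T5LocalNormIndex

open IsDedekindDomain HeightOneSpectrum IsLocalRing WithZero T5AdicCompletionNormGroup

/-- A uniformiser of the integers of a completion exists: the image of a global uniformiser. -/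
theorem exists_irreducible_adicCompletionIntegers {M : Type*} [Field M] [NumberField M]
    (u : HeightOneSpectrum (NumberField.RingOfIntegers M)) :
    ∃ ϖ : adicCompletionIntegers M u, Irreducible ϖ := by
  obtain ⟨ϖ, hϖ⟩ := intValuation_exists_uniformizer u
  set x : adicCompletion M u := ((algebraMap (NumberField.RingOfIntegers M) M ϖ : M) : adicCompletion M u)
    with hx
  have hval : Valued.v x = exp (-1) := by
    rw [hx, valuedAdicCompletion_eq_valuation', valuation_of_algebraMap, hϖ]
  refine ⟨⟨x, ?_⟩, ?_⟩
  · rw [mem_adicCompletionIntegers, hval, ← exp_zero, exp_le_exp]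
    norm_num
  · rw [T5AdicCompletionConductor.irreducible_iff_val_eq_exp_neg_one]
    exact hval

variable {K : Type*} [Field K] [NumberField K] (v : HeightOneSpectrum (NumberField.RingOfIntegers K))
  {L : Type*} [Field L] [NumberField L] [Algebra K L]
  (w : HeightOneSpectrum (NumberField.RingOfIntegers L)) [w.asIdeal.LiesOver v.asIdeal]
  (σ : Gal(adicCompletion L w/adicCompletion K v))
  (h2 : Module.finrank (adicCompletion K v) (adicCompletion L w) = 2) (hσ : σ ≠ 1)

include h2 hσ in
/-- THE LOCAL NORM INDEX THEOREM FOR A QUADRATIC EXTENSION OF COMPLETIONS, EVERY CASE: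
`[Kvˣ : N Lwˣ] = 2` (inert: `T5AdicCompletionNormGroup`; ramified, any residue characteristic:
`T5QuadraticNormIndex`). -/
theorem index_normGroup_eq_two : (normGroup v w σ).index = 2 := by
  obtain ⟨ϖ, hϖ⟩ := exists_irreducible_adicCompletionIntegers v
  obtain ⟨π, hπ⟩ := exists_irreducible_adicCompletionIntegers w
  by_cases hS : Irreducible (algebraMap (adicCompletionIntegers K v) (adicCompletionIntegers L w) ϖ)
  · exact T5AdicCompletionNormGroup.index_normGroup_eq_two v w σ h2 hϖ hS hσ
  · exact T5QuadraticNormIndex.index_normGroup_eq_two_of_ramified v w σ h2 hϖ hπ hS hσ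

include h2 hσ in
/-- The norm group is a proper subgroup: some `y ∈ Kvˣ` is not a norm. -/
theorem normGroup_ne_top : normGroup v w σ ≠ ⊤ := by
  intro h
  have := index_normGroup_eq_two v w σ h2 hσ
  rw [h, Subgroup.index_top] at this
  exact absurd this (by norm_num)

include h2 hσ in
/-- `η_v` EXISTS at every non-split place: the character `normChar` of `T5LocalNormCharacter`
(`Kvˣ →* ℤˣ`, kernel exactly the norm group) is available from `[Lw : Kv] = 2` and `σ ≠ 1` alone. -/
theorem normChar_eq_one_iff (y : (adicCompletion K v)ˣ) :
    T5LocalNormCharacter.normChar v w σ (index_normGroup_eq_two v w σ h2 hσ) y = 1 ↔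
      y ∈ normGroup v w σ :=
  T5LocalNormCharacter.normChar_eq_one_iff v w σ _ y

section Ramified

variable {ϖ : adicCompletionIntegers K v} (hϖ : Irreducible ϖ)
  {π : adicCompletionIntegers L w} (hπ : Irreducible π)
  (hram : ¬ Irreducible (algebraMap (adicCompletionIntegers K v) (adicCompletionIntegers L w) ϖ))

include h2 hσ hϖ hπ hram in
/-- At a RAMIFIED place (any residue characteristic) some UNIT is not a norm — `η_v` is RAMIFIED
(`normGroup ⊔ O_Kvˣ = ⊤` by the uniformiser `N π`, and `normGroup ≠ ⊤`). -/
theorem exists_mem_adicIntegerUnits_notMem_normGroup :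
    ∃ u ∈ T5AdicCompletionEmbedding.adicIntegerUnits v, u ∉ normGroup v w σ := by
  by_contra h
  have hle : T5AdicCompletionEmbedding.adicIntegerUnits v ≤ normGroup v w σ := fun u hu => by
    by_contra hn
    exact h ⟨u, hu, hn⟩
  have htop := T5RamifiedNormTransfer.normGroup_sup_adicIntegerUnits_eq_top v w σ h2 hϖ hπ hram hσ
  rw [sup_eq_left.mpr hle] at htop
  exact normGroup_ne_top v w σ h2 hσ htop

include h2 hσ hϖ hπ hram in
/-- `η_v = −1` at some unit of a ramified place. -/
theorem exists_mem_adicIntegerUnits_normChar_eq_neg_one :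
    ∃ u ∈ T5AdicCompletionEmbedding.adicIntegerUnits v,
      T5LocalNormCharacter.normChar v w σ (index_normGroup_eq_two v w σ h2 hσ) u = -1 := by
  obtain ⟨u, hu, hn⟩ := exists_mem_adicIntegerUnits_notMem_normGroup v w σ h2 hσ hϖ hπ hram
  exact ⟨u, hu, T5LocalNormCharacter.normChar_apply_of_notMem v w σ _ hn⟩

end Ramified

section Unramified

variable {ϖ : adicCompletionIntegers K v} (hϖ : Irreducible ϖ)
  {π : adicCompletionIntegers L w} (hπ : Irreducible π)

include h2 hσ hϖ hπ in
/-- `η_v` UNRAMIFIED ⇒ the place is unramified: if every unit of `Kv` is a norm, a uniformiser of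
`O_Kv` stays irreducible in `O_Lw` (the place is inert). -/
theorem irreducible_algebraMap_of_adicIntegerUnits_le
    (hle : T5AdicCompletionEmbedding.adicIntegerUnits v ≤ normGroup v w σ) :
    Irreducible (algebraMap (adicCompletionIntegers K v) (adicCompletionIntegers L w) ϖ) := by
  by_contra hram
  obtain ⟨u, hu, hn⟩ := exists_mem_adicIntegerUnits_notMem_normGroup v w σ h2 hσ hϖ hπ hram
  exact hn (hle hu)

include h2 hσ hϖ hπ in
/-- `η_v` is unramified ⟺ the place is unramified (`η_v` trivial on `O_Kvˣ` ⟺ `alg ϖ` irreducible). -/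
theorem adicIntegerUnits_le_normGroup_iff :
    T5AdicCompletionEmbedding.adicIntegerUnits v ≤ normGroup v w σ ↔
      Irreducible (algebraMap (adicCompletionIntegers K v) (adicCompletionIntegers L w) ϖ) := by
  refine ⟨irreducible_algebraMap_of_adicIntegerUnits_le v w σ h2 hσ hϖ hπ, fun hS u hu => ?_⟩
  exact T5AdicCompletionNormGroup.mem_normGroup_of_val_eq_one v w σ h2 hϖ hS hσ
    ((T5RamifiedNormTransfer.mem_adicIntegerUnits_iff_val_eq_one v u).mp hu)

end Unramified


section WildConductor




section ResidueCharacteristicTwo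

variable (h2n : ¬ IsUnit (2 : adicCompletionIntegers K v))

include h2n in
/-- The residue field has characteristic `2` when `2` is not a unit of `O_Kv`. -/
theorem charP_residueField_two : CharP (ResidueField (adicCompletionIntegers K v)) 2 := by
  rw [CharP.charP_iff_prime_eq_zero Nat.prime_two]
  have h : ((2 : ℕ) : ResidueField (adicCompletionIntegers K v)) =
      residue (adicCompletionIntegers K v) ((2 : ℕ) : adicCompletionIntegers K v) := by
    rw [map_natCast]
  rw [h, residue_eq_zero_iff, mem_maximalIdeal, mem_nonunits_iff, Nat.cast_ofNat]
  exact h2n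

include h2n in
/-- `|k| = 2 ^ n` with `n ≥ 1`. -/
theorem exists_card_residueField_eq_two_pow :
    ∃ n : ℕ, 0 < n ∧ Nat.card (ResidueField (adicCompletionIntegers K v)) = 2 ^ n := by
  haveI := charP_residueField_two v h2n
  haveI : Fintype (ResidueField (adicCompletionIntegers K v)) := Fintype.ofFinite _
  obtain ⟨n, -, hn⟩ := FiniteField.card (ResidueField (adicCompletionIntegers K v)) 2
  exact ⟨n, n.pos, by rw [Nat.card_eq_fintype_card, hn]⟩

include h2n in
/-- `[O_Kvˣ : U¹] = |k| − 1` is ODD in residue characteristic `2`. -/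
theorem odd_index_principalUnits : Odd (T5UnitsResidueQuotient.principalUnits v).index := by
  rw [T5UnitsResidueQuotient.index_principalUnits]
  obtain ⟨n, hn0, hn⟩ := exists_card_residueField_eq_two_pow v h2n
  rw [hn]
  exact Nat.Even.sub_odd Nat.one_le_two_pow (Nat.even_pow.mpr ⟨even_two, hn0.ne'⟩) odd_one

end ResidueCharacteristicTwo

section Units

/-- A principal unit of `O_Kv` (`residue u = 1`) satisfies `v (u − 1) < 1` in `Kv`. -/
theorem val_sub_one_lt_one_of_mem_principalUnits {u : (adicCompletionIntegers K v)ˣ}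
    (hu : u ∈ T5UnitsResidueQuotient.principalUnits v) :
    Valued.v (((u : adicCompletionIntegers K v) : adicCompletion K v) - 1) < 1 := by
  rw [T5UnitsResidueQuotient.mem_principalUnits_iff] at hu
  have hm : (u : adicCompletionIntegers K v) - 1 ∈ maximalIdeal (adicCompletionIntegers K v) := by
    rw [← residue_eq_zero_iff, map_sub, map_one, hu, sub_self]
  have := (T5AdicCompletionResidueField.mem_maximalIdeal_iff v _).mp hm
  simpa using this

end Units

section Main

variable {ϖ : adicCompletionIntegers K v} (hϖ : Irreducible ϖ)
  {π : adicCompletionIntegers L w} (hπ : Irreducible π)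
  (hram : ¬ Irreducible (algebraMap (adicCompletionIntegers K v) (adicCompletionIntegers L w) ϖ))

include h2 hϖ hπ hram hσ in
/-- The norm group pulled back to `O_Kvˣ` has index `2` there (ramified place, any residue
characteristic). -/
theorem index_comap_normGroup_eq_two :
    ((normGroup v w σ).comap (Units.map ((adicCompletionIntegers K v).subtype :
      adicCompletionIntegers K v →* adicCompletion K v))).index = 2 := by
  have hr : (Units.map ((adicCompletionIntegers K v).subtype :
      adicCompletionIntegers K v →* adicCompletion K v)).range =
      T5AdicCompletionEmbedding.adicIntegerUnits v := rfl
  rw [Subgroup.index_comap, hr, ← T5RamifiedNormTransfer.index_normGroup_eq_relIndex v w σ h2 hϖ hπ hram hσ]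
  exact T5QuadraticNormIndex.index_normGroup_eq_two_of_ramified v w σ h2 hϖ hπ hram hσ

variable (h2n : ¬ IsUnit (2 : adicCompletionIntegers K v))

include h2 hϖ hπ hram hσ h2n in
/-- WILD RAMIFIED ⇒ some PRINCIPAL unit of `Kv` is not a norm: the conductor exponent of `η_v` is `≥ 2`. -/
theorem exists_val_sub_one_lt_one_notMem_normGroup :
    ∃ y : (adicCompletion K v)ˣ, Valued.v ((y : adicCompletion K v) - 1) < 1 ∧ y ∉ normGroup v w σ := by
  by_contra h
  have hall : ∀ y : (adicCompletion K v)ˣ, Valued.v ((y : adicCompletion K v) - 1) < 1 →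
      y ∈ normGroup v w σ := by
    intro y hy
    by_contra hn
    exact h ⟨y, hy, hn⟩
  have hle : T5UnitsResidueQuotient.principalUnits v ≤
      (normGroup v w σ).comap (Units.map ((adicCompletionIntegers K v).subtype :
        adicCompletionIntegers K v →* adicCompletion K v)) := by
    intro u hu
    rw [Subgroup.mem_comap]
    apply hall
    rw [Units.coe_map]
    exact val_sub_one_lt_one_of_mem_principalUnits v hu
  have hdvd := Subgroup.index_dvd_of_le hle
  rw [index_comap_normGroup_eq_two v w σ h2 hσ hϖ hπ hram] at hdvd
  exact (Nat.not_even_iff_odd.mpr (odd_index_principalUnits v h2n)) (even_iff_two_dvd.mpr hdvd)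

include h2 hϖ hπ hram hσ h2n in
/-- `η_v = −1` at some principal unit of a WILD ramified place. -/
theorem exists_val_sub_one_lt_one_normChar_eq_neg_one (hind : (normGroup v w σ).index = 2) :
    ∃ y : (adicCompletion K v)ˣ, Valued.v ((y : adicCompletion K v) - 1) < 1 ∧
      T5LocalNormCharacter.normChar v w σ hind y = -1 := by
  obtain ⟨y, hy, hn⟩ := exists_val_sub_one_lt_one_notMem_normGroup v w σ h2 hσ hϖ hπ hram h2n
  exact ⟨y, hy, T5LocalNormCharacter.normChar_apply_of_notMem v w σ hind hn⟩

end Main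


end WildConductor

section Summary


include h2 hσ in
/-- `η_v` is CONTINUOUS at every non-split place. -/
theorem normChar_continuous :
    Continuous (T5LocalNormCharacter.normChar v w σ (index_normGroup_eq_two v w σ h2 hσ)) :=
  T5NormGroupOpen.continuous_normChar_of_index_two v w σ _

include h2 hσ in
/-- `η_v` is trivial on squares: `η_v(x²) = 1`. -/
theorem normChar_sq (x : (adicCompletion K v)ˣ) :
    T5LocalNormCharacter.normChar v w σ (index_normGroup_eq_two v w σ h2 hσ) (x ^ 2) = 1 :=
  (T5LocalNormCharacter.normChar_eq_one_iff v w σ _ _).mpr (T5NormGroupOpen.sq_mem_normGroup v w σ x)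

include h2 hσ in
/-- `η_v = 1` on the units `≡ 1 (mod 4𝔪)`: the conductor exponent is `≤ 2 v_K(2) + 1`. -/
theorem normChar_eq_one_of_val_sub_one_lt_val_four (u : (adicCompletion K v)ˣ)
    (hu : Valued.v ((u : adicCompletion K v) - 1) < Valued.v (4 : adicCompletion K v)) :
    T5LocalNormCharacter.normChar v w σ (index_normGroup_eq_two v w σ h2 hσ) u = 1 :=
  (T5LocalNormCharacter.normChar_eq_one_iff v w σ _ u).mpr (T5NormGroupOpen.mem_normGroup_of_val_sub_one_lt_val_four v w σ u hu)

section Ramification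

variable {ϖ : adicCompletionIntegers K v} (hϖ : Irreducible ϖ)
  {π : adicCompletionIntegers L w} (hπ : Irreducible π)

include h2 hσ hϖ hπ in
/-- `η_v` is UNRAMIFIED (trivial on `O_Kvˣ`) iff the place is unramified (`alg ϖ` irreducible). -/
theorem forall_normChar_eq_one_iff_irreducible :
    (∀ u ∈ T5AdicCompletionEmbedding.adicIntegerUnits v,
        T5LocalNormCharacter.normChar v w σ (index_normGroup_eq_two v w σ h2 hσ) u = 1) ↔
      Irreducible (algebraMap (adicCompletionIntegers K v) (adicCompletionIntegers L w) ϖ) := by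
  rw [← adicIntegerUnits_le_normGroup_iff v w σ h2 hσ hϖ hπ]
  constructor
  · intro h u hu
    exact (T5LocalNormCharacter.normChar_eq_one_iff v w σ _ u).mp (h u hu)
  · intro h u hu
    exact (T5LocalNormCharacter.normChar_eq_one_iff v w σ _ u).mpr (h hu)

include h2 hσ hϖ hπ in
/-- RAMIFIED (any residue characteristic): `η_v = −1` at some unit. -/
theorem exists_mem_adicIntegerUnits_normChar_eq_neg_one'
    (hram : ¬ Irreducible (algebraMap (adicCompletionIntegers K v) (adicCompletionIntegers L w) ϖ)) :
    ∃ u ∈ T5AdicCompletionEmbedding.adicIntegerUnits v,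
      T5LocalNormCharacter.normChar v w σ (index_normGroup_eq_two v w σ h2 hσ) u = -1 :=
  exists_mem_adicIntegerUnits_normChar_eq_neg_one v w σ h2 hσ hϖ hπ hram

include h2 hσ hϖ hπ in
/-- WILD (ramified, `2 ∉ O_Kvˣ`): `η_v = −1` at some PRINCIPAL unit — the conductor exponent is `≥ 2`. -/
theorem exists_val_sub_one_lt_one_normChar_eq_neg_one'
    (hram : ¬ Irreducible (algebraMap (adicCompletionIntegers K v) (adicCompletionIntegers L w) ϖ))
    (h2n : ¬ IsUnit (2 : adicCompletionIntegers K v)) :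
    ∃ y : (adicCompletion K v)ˣ, Valued.v ((y : adicCompletion K v) - 1) < 1 ∧
      T5LocalNormCharacter.normChar v w σ (index_normGroup_eq_two v w σ h2 hσ) y = -1 :=
  exists_val_sub_one_lt_one_normChar_eq_neg_one v w σ h2 hσ hϖ hπ hram h2n _

include h2 hσ hϖ hπ in
/-- TAME (ramified, `2 ∈ O_Kvˣ`): `η_v = 1` on the principal units (conductor exponent exactly `1`)
and `η_v(−1) = −1 ⟺ q_v ≡ 3 (mod 4)`. -/
theorem tame_normChar_summary
    (hram : ¬ Irreducible (algebraMap (adicCompletionIntegers K v) (adicCompletionIntegers L w) ϖ))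
    (h2u : IsUnit (2 : adicCompletionIntegers K v)) :
    (∀ u : (adicCompletion K v)ˣ, Valued.v (u : adicCompletion K v) = 1 →
        Valued.v ((u : adicCompletion K v) - 1) < 1 →
        T5LocalNormCharacter.normChar v w σ (index_normGroup_eq_two v w σ h2 hσ) u = 1) ∧
      (T5LocalNormCharacter.normChar v w σ (index_normGroup_eq_two v w σ h2 hσ) (-1) = -1 ↔
        Nat.card (ResidueField (adicCompletionIntegers K v)) % 4 = 3) :=
  ⟨fun u hu hu1 => T5LocalNormCharacter.normChar_eq_one_of_val_sub_one_lt_one v w σ _ h2 hϖ hπ hram hσ h2u u hu hu1,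
    T5TameNormCharNegOne.normChar_neg_one_eq_neg_one_iff v w σ _ h2 hϖ hπ hram hσ h2u⟩

end Ramification


end Summary

end Summit.Ventures.HodgeRepro2.T5LocalNormIndex
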